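import Summits.HodgeConjecture.HodgeConjecture.Theses.HeckePrymWeil
import Summits.HodgeConjecture.HodgeConjecture.Theorems.HeckePrymWeilWeilTwelvefoldsSqrtMinus7WeilSignatureLemmas
import Summits.HodgeConjecture.HodgeConjecture.Theorems.HeckePrymWeilWeilTwelvefoldsSqrtMinus7WeilSignatureCoordinates
import Summits.HodgeConjecture.HodgeConjecture.Theorems.HeckePrymWeilWeilTwelvefoldsSqrtMinus7WeilSignatureHermitian
import Literature.AlgebraicGeometry.Motives.HyperbolicWeilType
import Literature.AlgebraicGeometry.Motives.RationalDegreeOneModelWeilType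
import Literature.AlgebraicGeometry.Motives.AbelianVarietyCohomologyExteriorH1
import Literature.AlgebraicGeometry.HodgeTheory.ComplexConjugation
import HarnessLib

/-!
# Crux `WeilTwelvefoldsSqrtMinus7` (stmt-HodgeConjecture-1261), line `amnesic-secant-sheaves-split-fourteenfolds` — stub `stub_weilSignatureOfModel` (α₂, r6)

**The signature `(n, n)` of the rational degree-one model of a polarized abelian variety of Weil type**
(B. van Geemen, *An introduction to the Hodge conjecture for abelian varieties*, LNM 1594 (1994),
Lemma 5.2 (4)–(5)), PROVED on the tree's real carriers `complexBetti A.X 1 = H¹(A(ℂ); ℂ)` in the exact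
shape `hPN` consumed by `Theorems.exists_isotropic_blockVectors'`.

Data: `(A, φ)` of dimension `2n`, `φ ≫ φ = -7`; a real Hodge model `M` on whose `H^{1,0}` the
eigenvalues `± i√7` of `φ^*` have multiplicity `n`; a rational `φ`-compatible class `h` (`φ^* h = 7 h`)
satisfying Hodge–Riemann in degree one (`i · h^{2n-1} ⌣ x ⌣ x̄ ∈ ℝ_{>0} · ω₀` on `H^{1,0} ∖ 0`, a
HYPOTHESIS, the shape of the named fact `hodgeRiemann_degreeOne`); a rational degree-one model
`(u, M_A, ω, G_A)` of `(A, φ, h)`. Conclusion: the symmetric rational form `S(v, w) = v ⬝ G_A (M_A w)`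
(`= Q_h(v̂, φ^*ŵ)/ω`) is positive definite on an `M_A`-stable `ℚ`-subspace `P` and negative definite on an
`M_A`-stable `N`, both of dimension `2n`, `P ⊓ N = 0`.

Proof (van Geemen 5.2 (2), (4), (5)), in three landed helper files of this directory:
`…WeilSignatureCoordinates` (coordinates in the rational basis `u`: `φ^*` acts by `M_A`, `Q_h` is
`(x ⬝ G_A y) ω`, conjugation is coordinatewise, `M_A² = -7`), `…WeilSignatureHermitian` (van Geemen's
Hermitian form `Re (x ⬝ G_A M_A ȳ)` is definite of opposite signs on `Z₁ = V₊^{1,0} ⊕ V₋^{0,1}` and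
`Z₂ = V₋^{1,0} ⊕ V₊^{0,1}`, each of complex dimension `≥ 2n`: Weil type makes `V_±` isotropic,
Hodge–Riemann makes `H` definite on `V_±^{1,0}`, conjugation swaps the pieces) and
`…WeilSignatureLemmas` (rational `M_A`-stable definite subspaces of dimension `2n` built one `K`-line at a
time by a dimension count in `ℂ^{4n}` and density of `ℚ` in `ℝ`). This file supplies the geometric inputs:
`G_A` is alternating (`Motives.gram_antisymm`) and of Weil type (`Motives.gram_map_eq_mul_gram`, with
`b₁ = 2 dim A` and "`H^{4n}` is spanned by products" from `Motives.abelianVarietyCohomologyExteriorH1_holds`),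
`(φ^*)² = -7` on `H¹` (`complexBetti_map_map_one_of_comp_self`), `φ^*` commutes with conjugation
(`conjClass_map`), conjugation swaps `H^{1,0}` and `H^{0,1}` of the real model
(`HodgeModel.IsReal.isHodgeSymmetric`), and the Hodge–Riemann class `ω₀` is a REAL multiple of `ω`
(rational classes are real, `IsRationalClass.conjClass_eq`). No named fact is taken.
-/

noncomputable section

set_option linter.dupNamespace false

open CategoryTheory Complex
open scoped Matrix
open Literature.AlgebraicGeometry Literature.AlgebraicGeometry.Motives
  Literature.AlgebraicGeometry.HodgeTheory Literature.AlgebraicTopology.SingularHomology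

namespace Summit.HodgeConjecture.HodgeConjecture.Theorems.WeilTwelvefoldsSqrtMinus7.AmnesicSecantSheaves

/-- **Stub α₂ (r6) — the signature `(n, n)` of the rational degree-one model** (van Geemen, LNM 1594,
Lemma 5.2 (4)–(5), on the carriers, in the EXACT shape `hPN` consumed by
`Theorems.exists_isotropic_blockVectors'`). See the module docstring for the data, the conclusion and the
proof. [cite: vanGeemen1994HodgeAV, Lemma 5.2 (2), (4), (5) with proof] -/
theorem stub_weilSignatureOfModel :
    ∀ (n : ℕ) (A : AbelianVariety ℂ) (φ : A ⟶ A), A.dim = 2 * n → φ ≫ φ = -((7 : ℤ) • 𝟙 A) →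
    ∀ (M : HodgeModel (2 * n) A.X), M.IsReal →
      Module.finrank ℂ ↥(Module.End.eigenspace (complexBetti.map φ.hom.hom.hom 1).hom
            (Complex.I * (Real.sqrt (7 : ℝ) : ℂ)) ⊓ (M.hodgePQ 1 1 0).comap (M.pullback 1).hom) = n →
      Module.finrank ℂ ↥(Module.End.eigenspace (complexBetti.map φ.hom.hom.hom 1).hom
            (-(Complex.I * (Real.sqrt (7 : ℝ) : ℂ))) ⊓ (M.hodgePQ 1 1 0).comap (M.pullback 1).hom) = n →
    ∀ (h : complexBetti A.X 2), IsRationalClass h → complexBetti.map φ.hom.hom.hom 2 h = (7 : ℂ) • h →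
      (∃ ω₀ : complexBetti A.X (2 + 2 * (2 * n - 1)), IsRationalClass ω₀ ∧ ω₀ ≠ 0 ∧
        ∀ x : complexBetti A.X 1, M.pullback 1 x ∈ M.hodgePQ 1 1 0 → x ≠ 0 →
          ∃ t : ℝ, 0 < t ∧
            Complex.I • polarizationPairingOne A.X h (2 * n - 1) x (conjClass (ComplexPoints A.X) 1 x) =
              (t : ℂ) • ω₀) →
    ∀ (ι : Type) [Fintype ι] [DecidableEq ι] (u : ι → complexBetti A.X 1),
      (∀ i, IsRationalClass (u i)) → LinearIndependent ℂ u → Submodule.span ℂ (Set.range u) = ⊤ →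
    ∀ (MA : Matrix ι ι ℚ),
      (∀ i, complexBetti.map φ.hom.hom.hom 1 (u i) = ∑ j, ((MA j i : ℚ) : ℂ) • u j) →
    ∀ (ω : complexBetti A.X (2 + 2 * (2 * n - 1))) (GA : Matrix ι ι ℚ), IsRationalClass ω → ω ≠ 0 →
      (∀ i j, polarizationPairingOne A.X h (2 * n - 1) (u i) (u j) = ((GA i j : ℚ) : ℂ) • ω) →
    ∃ P N : Submodule ℚ (ι → ℚ), (∀ v ∈ P, MA.mulVec v ∈ P) ∧ (∀ v ∈ N, MA.mulVec v ∈ N) ∧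
      Module.finrank ℚ P = 2 * n ∧ Module.finrank ℚ N = 2 * n ∧ P ⊓ N = ⊥ ∧
      (∀ x ∈ P, x ≠ 0 → 0 < x ⬝ᵥ GA.mulVec (MA.mulVec x)) ∧
      (∀ x ∈ N, x ≠ 0 → x ⬝ᵥ GA.mulVec (MA.mulVec x) < 0) := by
  intro n A φ hA hφ M hM hVp hVm h _hh hφh hHR ι _ _ u hu hind hspan MA hMAu ω GA hω hω0 hG
  classical
  -- the degenerate case `n = 0`
  rcases Nat.eq_zero_or_pos n with hn0 | hn
  · subst hn0
    refine ⟨⊥, ⊥, fun v hv => ?_, fun v hv => ?_, by simp, by simp, by simp, fun x hx hx0 => ?_,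
      fun x hx hx0 => ?_⟩
    · rw [(Submodule.mem_bot ℚ).1 hv, Matrix.mulVec_zero]; exact Submodule.zero_mem _
    · rw [(Submodule.mem_bot ℚ).1 hv, Matrix.mulVec_zero]; exact Submodule.zero_mem _
    · exact absurd ((Submodule.mem_bot ℚ).1 hx) hx0
    · exact absurd ((Submodule.mem_bot ℚ).1 hx) hx0
  -- notation
  haveI : Module.Finite ℂ (complexBetti A.X 1) := finite_complexBetti_abelianVariety A 1
  set T : complexBetti A.X 1 →ₗ[ℂ] complexBetti A.X 1 := (complexBetti.map φ.hom.hom.hom 1).hom with hT_def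
  set Q := polarizationPairingOne A.X h (2 * n - 1) with hQ_def
  set κ : complexBetti A.X 1 → complexBetti A.X 1 := conjClass (ComplexPoints A.X) 1 with hκ_def
  set H10 : Submodule ℂ (complexBetti A.X 1) := (M.hodgePQ 1 1 0).comap (M.pullback 1).hom with hH10_def
  set H01 : Submodule ℂ (complexBetti A.X 1) := (M.hodgePQ 1 0 1).comap (M.pullback 1).hom with hH01_def
  have hφ' : φ ≫ φ = -((7 : ℕ) • 𝟙 A) := by rw [← ofNat_zsmul]; exact hφ
  -- the rational basis `u` and coordinates
  let b : Module.Basis ι ℂ (complexBetti A.X 1) := Module.Basis.mk hind hspan.ge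
  have hbu : ⇑b = u := Module.Basis.coe_mk _ _
  set β : complexBetti A.X 1 ≃ₗ[ℂ] (ι → ℂ) := b.equivFun with hβ_def
  have hTb : ∀ i, T (b i) = ∑ j, ((MA j i : ℚ) : ℂ) • b j := fun i => by rw [hbu]; exact hMAu i
  have hQb : ∀ i j, Q (b i) (b j) = ((GA i j : ℚ) : ℂ) • ω := fun i j => by rw [hbu]; exact hG i j
  have hbrat : ∀ i, IsRationalClass (b i) := fun i => by rw [hbu]; exact hu i
  have hβT : ∀ x, β (T x) = (MA.map (algebraMap ℚ ℂ)).mulVec (β x) := weilSig_equivFun_map b hTb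
  have hβQ : ∀ x y, Q x y = (β x ⬝ᵥ (GA.map (algebraMap ℚ ℂ)).mulVec (β y)) • ω := weilSig_pairing_eq b hQb
  have hβκ : ∀ x, β (κ x) = star (β x) := weilSig_equivFun_conjClass b hbrat
  -- `(φ^*)² = -7`, hence `M_A² = -7`
  have hTT : ∀ x, T (T x) = -(((7 : ℚ) : ℂ) • x) := fun x => by
    rw [show ((7 : ℚ) : ℂ) = ((7 : ℕ) : ℂ) by norm_num]
    exact complexBetti_map_map_one_of_comp_self hφ' x
  have hMA : MA * MA = (-7 : ℚ) • (1 : Matrix ι ι ℚ) := weilSig_matrix_sq b hTb hTT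
  -- `G_A` is alternating and of Weil type
  have hGA : GA.transpose = -GA := by
    ext i k
    rw [Matrix.transpose_apply, Matrix.neg_apply]
    exact gram_antisymm h (2 * n - 1) u hω0 GA hG k i
  have hA' : A.dim = 2 * n - 1 + 1 := by omega
  have hh7 : complexBetti.map φ.hom.hom.hom 2 h = ((7 : ℕ) : ℂ) • h := by rw [Nat.cast_ofNat]; exact hφh
  have hWt : MA.transpose * GA * MA = (7 : ℚ) • GA := by
    ext i k
    have e := gram_map_eq_mul_gram hA' (abelianVarietyCohomologyExteriorH1_holds.finrank_one A)
      (abelianVarietyCohomologyExteriorH1_holds.span_range_cupPowOne A _) (d := 7) (by norm_num) hφ' hh7 u MA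
      hMAu hω0 GA hG i k
    rw [Matrix.smul_apply, smul_eq_mul, show ((7 : ℕ) : ℚ) * GA i k = 7 * GA i k by norm_num] at *
    rw [← e]
    simp only [Matrix.mul_apply, Matrix.transpose_apply, Finset.sum_mul]
    rw [Finset.sum_comm]
  -- conjugation: commutes with `φ^*`, is conjugate-linear, swaps the Hodge pieces of the real model
  have hTκ : ∀ x, T (κ x) = κ (T x) := fun x => (conjClass_map _ x).symm
  have hκs : ∀ (c : ℂ) (x : complexBetti A.X 1), κ (c • x) = (starRingEnd ℂ) c • κ x :=
    fun c x => conjClass_smul c x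
  have hκpq : ∀ (p q : ℕ) (x : complexBetti A.X 1), M.pullback 1 x ∈ M.hodgePQ 1 p q →
      M.pullback 1 (κ x) ∈ M.hodgePQ 1 q p := fun p q x hx => by
    rw [hκ_def, ← conjClass_map]
    exact hM.isHodgeSymmetric 1 p q _ hx
  have hκ01 : ∀ x ∈ H01, κ x ∈ H10 := fun x hx => hκpq 0 1 x hx
  have hκ10 : ∀ x ∈ H10, κ x ∈ H01 := fun x hx => hκpq 1 0 x hx
  -- the eigenvalue `s = i√7 = √7 · i`
  have hm : (0 : ℝ) < Real.sqrt 7 := Real.sqrt_pos.2 (by norm_num)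
  have hm7 : Real.sqrt 7 * Real.sqrt 7 = 7 := Real.mul_self_sqrt (by norm_num)
  have hs : Complex.I * (Real.sqrt (7 : ℝ) : ℂ) = (Real.sqrt 7 : ℂ) * Complex.I := mul_comm _ _
  -- the Hodge–Riemann class `ω₀` is a real multiple `ρ ω` of `ω`
  obtain ⟨ω₀, hω₀rat, hω₀0, hHRω⟩ := hHR
  have hne : Module.End.eigenspace T (Complex.I * (Real.sqrt (7 : ℝ) : ℂ)) ⊓ H10 ≠ ⊥ := fun h0 => by
    rw [h0, finrank_bot] at hVp
    omega
  obtain ⟨x₀, hx₀, hx₀0⟩ := Submodule.exists_mem_ne_zero_of_ne_bot hne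
  obtain ⟨t₀, ht₀, e₀⟩ := hHRω x₀ hx₀.2 hx₀0
  set ρc : ℂ := (t₀ : ℂ)⁻¹ * (Complex.I * (β x₀ ⬝ᵥ (GA.map (algebraMap ℚ ℂ)).mulVec (β (κ x₀)))) with hρc_def
  have hω₀ : ω₀ = ρc • ω := by
    have ht0' : (t₀ : ℂ) ≠ 0 := by exact_mod_cast ht₀.ne'
    calc ω₀ = (t₀ : ℂ)⁻¹ • ((t₀ : ℂ) • ω₀) := by rw [smul_smul, inv_mul_cancel₀ ht0', one_smul]
      _ = ρc • ω := by rw [← e₀, hβQ, smul_smul, smul_smul, hρc_def, mul_assoc]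
  have hρreal : (starRingEnd ℂ) ρc = ρc := by
    have h1 : conjClass (ComplexPoints A.X) _ ω₀ = ω₀ := hω₀rat.conjClass_eq
    rw [hω₀, conjClass_smul, hω.conjClass_eq] at h1
    have h2 : ((starRingEnd ℂ) ρc - ρc) • ω = 0 := by rw [sub_smul, h1, sub_self]
    rcases smul_eq_zero.1 h2 with h3 | h3
    · exact sub_eq_zero.1 h3
    · exact absurd h3 hω0
  set ρ : ℝ := ρc.re with hρ_def
  have hρc : ρc = (ρ : ℂ) := (Complex.conj_eq_iff_re.1 hρreal).symm
  have hρ0 : ρ ≠ 0 := fun h0 => hω₀0 (by rw [hω₀, hρc, h0, Complex.ofReal_zero, zero_smul])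
  have hHR' : ∀ x ∈ H10, x ≠ 0 → ∃ t : ℝ, 0 < t ∧ Complex.I • Q x (κ x) = ((t : ℂ) * ρ) • ω := by
    intro x hx hx0
    obtain ⟨t, ht, e⟩ := hHRω x hx hx0
    exact ⟨t, ht, by rw [e, hω₀, hρc, smul_smul]⟩
  -- the two definite pieces (part III) and the rational definite subspaces (part I)
  obtain ⟨Zp, Zn, hZp, hZn, hpos, hneg⟩ := weilSig_exists_Zp_Zn T Q κ β hω0 hMA hGA hWt hβT hβQ hβκ hTκ hκs
    hm hm7 hs H10 H01 hκ01 hκ10 hVp hVm hρ0 hHR'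
  exact weilSig_exists_PN (by norm_num) hMA hGA hWt n Zp Zn hZp hZn hpos hneg

end Summit.HodgeConjecture.HodgeConjecture.Theorems.WeilTwelvefoldsSqrtMinus7.AmnesicSecantSheaves

end
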